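import Literature.IUT.LogVolume.LogVolume
import Mathlib.MeasureTheory.Constructions.Pi
import Mathlib.MeasureTheory.Measure.Haar.Basic
import HarnessLib

/-!
# Direct sums of volume spaces: product integral structures and weighted log-volumes

[IUTchIII] Prop. 3.1 / Rmk. 3.1.1 and [IUTchIV] Prop. 1.4 (i) consider log-volumes on DIRECT SUMS of
finitely many nonarchimedean local fields (the direct summand fields of a tensor packet
`log(^A F_{v_ℚ}) = ⊕ ⊗ K_{v_α}`, resp. "tensor products of finitely many finite extensions of `ℚ_p` …
decompose, naturally, as direct sums of finitely many finite extensions of `ℚ_p`"), each summand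
carrying its own integral structure, and WEIGHTED sums of the summands' log-volumes:

* [IUTchIII] Rmk. 3.1.1 (ii) (kurims p. 94): "it will be necessary to consider these log-volumes on
  the portion of `log(^αF_v)` corresponding to `K_v` relative to the weight `[K_v : (F_mod)_v]⁻¹` …
  When, moreover, we consider direct sums over all `v ∈ V` lying over a given `v_ℚ ∈ V_ℚ` … it will be
  convenient to use the normalized weight `1 / ([K_v : (F_mod)_v] · Σ_{V_mod ∋ w | v_ℚ} [(F_mod)_w :
  ℚ_{v_ℚ}])` — i.e., normalized so that multiplication by `p_{v_ℚ}` affects log-volumes by addition or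
  subtraction … of the quantity `log(p_{v_ℚ}) ∈ ℝ`";
* Rmk. 3.1.1 (iii) (p. 95): "such weighted sums of log-volumes do not, in general, arise as some
  positive real multiple of the [natural] logarithm of a "volume" … in the usual sense of measure
  theory", whence the restriction to "a region that arises as a direct product of compact subsets of
  positive measure in each of the direct summands … a direct product region"; Rmk. 3.1.1 (iv) final
  display (p. 97): "`(1/N_E)·μ^log_E(S) = Σ_{v∈V} (1/N_v)·μ^log_v(S_v)`" for `S = ∏ S_v`;
* [IUTchIV] Prop. 1.4 (i) (p. 13): on such a direct sum "normalized so that `μ^log((R_E)^∼) = 0`,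
  `μ^log(p·(R_E)^∼) = −log(p)`" (uniform weight `1/dim`).

Contents, for a finite family `(V_j, Λ_j)_{j∈J}` of groups with integral structures (`NormalizedHaar.lean`):
(1) the product integral structure `IntegralStructure.pi Λ = ∏ Λ_j` on `Π j, V j`, `(pi Λ).haar =
Measure.pi (Λ_j.haar)` and the BOX FORMULA `μ(∏ A_j) = ∏ μ_j(A_j)`, `μ^log(∏ A_j) = Σ μ^log_j(A_j)`;
(2) DIRECT PRODUCT REGIONS and the WEIGHTED LOG-VOLUME `Σ_j w_j · μ^log_j(A_j)` with its invariance,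
monotonicity and the normalisation theorem `weightedLogVolume_image_of_relIndex_eq_pow`: if
`[Λ_j : φ_j(Λ_j)] = b^{D_j}` and `Σ_j w_j D_j = 1` then the weighted log-volume drops by exactly `log b`
("multiplication by `p_{v_ℚ}` affects log-volumes by … subtraction of `log(p_{v_ℚ})`"); (3) Mochizuki's
normalized weight `normalizedWeight N D j = 1/(N_j · Σ_i D_i)` with `Σ_j w_j · (N_j D_j) = 1`.
[cite: Mochizuki2012, IUTchIII Rmk. 3.1.1 (ii)–(iv) pp. 94–97; IUTchIV Prop. 1.4 (i) p. 13]
Deliberately NOT here: the `E`-weighted MEASURE of Rmk. 3.1.1 (iv) on arbitrary Borel sets (a separate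
file), local fields (see `LocalFieldVolume.lean` / `PacketVolume.lean`), any judgement on Cor. 3.12.
-/

noncomputable section

open MeasureTheory MeasureTheory.Measure Set TopologicalSpace
open scoped ENNReal NNReal Pointwise

namespace Literature.IUT.LogVolume

namespace IntegralStructure

variable {J : Type*} [Fintype J] {V : J → Type*} [∀ j, AddCommGroup (V j)]
  [∀ j, TopologicalSpace (V j)]

/-! ### (1) The product integral structure and the box formula -/

/-- The **direct sum integral structure** `∏_j Λ_j ⊆ ⊕_j V_j` ("the integral structures … on each of
the direct summand … fields", [IUTchIII] Prop. 3.9 (i); "`(R_E)^∼` decomposes as a direct sum",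
[IUTchIV] Prop. 1.4 (i)). [cite: Mochizuki2012, IUTchIV Prop. 1.4 (i) p. 13] -/
def pi (Λ : ∀ j, IntegralStructure (V j)) : IntegralStructure (Π j, V j) :=
  ⟨⟨AddSubgroup.pi univ (fun j => (Λ j).toOpenAddSubgroup.toAddSubgroup),
    by
      change IsOpen (AddSubgroup.pi univ (fun j => (Λ j).toOpenAddSubgroup.toAddSubgroup) :
        Set (Π j, V j))
      rw [AddSubgroup.coe_pi]
      exact isOpen_set_pi finite_univ (fun j _ => (Λ j).isOpen)⟩,
    by
      change IsCompact (AddSubgroup.pi univ (fun j => (Λ j).toOpenAddSubgroup.toAddSubgroup) :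
        Set (Π j, V j))
      rw [AddSubgroup.coe_pi]
      exact isCompact_univ_pi (fun j => (Λ j).isCompact)⟩

variable (Λ : ∀ j, IntegralStructure (V j))

/-- `∏ Λ_j` as a set is the box `Set.pi univ Λ_j`. [cite: Mochizuki2012, IUTchIV Prop. 1.4 (i) p. 13] -/
@[simp] theorem coe_pi : (pi Λ : Set (Π j, V j)) = Set.pi univ (fun j => (Λ j : Set (V j))) := rfl

variable [∀ j, IsTopologicalAddGroup (V j)] [∀ j, MeasurableSpace (V j)] [∀ j, BorelSpace (V j)]
  [∀ j, SecondCountableTopology (V j)] [∀ j, LocallyCompactSpace (V j)]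

/-- **The volume of a direct sum is the product measure**: `μ_{∏Λ} = ⊗_j μ_{Λ_j}` (uniqueness of
Haar measure; both give the box `∏ Λ_j` volume `1`). [cite: Mochizuki2012, IUTchIII Rmk. 3.1.1 (iii) p. 95] -/
theorem pi_haar_eq : (pi Λ).haar = Measure.pi (fun j => (Λ j).haar) := by
  have h := addHaarMeasure_unique (Measure.pi (fun j => (Λ j).haar)) (pi Λ).positiveCompacts
  have hc : Measure.pi (fun j => (Λ j).haar) ((pi Λ).positiveCompacts : Set (Π j, V j)) = 1 := by
    rw [coe_positiveCompacts, coe_pi, Measure.pi_pi]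
    simp [haar_self]
  rw [hc, one_smul] at h
  exact h.symm

/-- **Box formula**: `μ_{∏Λ}(∏_j A_j) = ∏_j μ_{Λ_j}(A_j)` ("the volume/measure of such a compact subset
may be computed …" for direct product regions). [cite: Mochizuki2012, IUTchIII Rmk. 3.1.1 (iii) p. 95] -/
theorem pi_haar_pi (A : ∀ j, Set (V j)) :
    (pi Λ).haar (Set.pi univ A) = ∏ j, (Λ j).haar (A j) := by
  rw [pi_haar_eq, Measure.pi_pi]

/-- Log form of the box formula: `μ^log_{∏Λ}(∏ A_j) = Σ_j μ^log_{Λ_j}(A_j)` for factors of positive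
finite volume. [cite: Mochizuki2012, IUTchIII Rmk. 3.1.1 (iv) p. 97] -/
theorem pi_logVolume_pi (A : ∀ j, Set (V j)) (hA : ∀ j, 0 < (Λ j).haar (A j))
    (hA' : ∀ j, (Λ j).haar (A j) < ∞) :
    (pi Λ).logVolume (Set.pi univ A) = ∑ j, (Λ j).logVolume (A j) := by
  unfold logVolume
  rw [pi_haar_pi, ENNReal.toReal_prod, Real.log_prod]
  intro j _
  exact (ENNReal.toReal_pos (hA j).ne' (hA' j).ne).ne'

/-! ### (2) Direct product regions and weighted log-volumes -/

/-- A **direct product region** of `⊕_j V_j`: "a region that arises as a direct product of compact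
subsets of positive measure in each of the direct summands" — recorded as the family of factors.
[cite: Mochizuki2012, IUTchIII Rmk. 3.1.1 (iii) p. 95] -/
@[mk_iff]
structure IsDirectProductRegion (A : ∀ j, Set (V j)) : Prop where
  /-- each factor is compact -/
  isCompact : ∀ j, IsCompact (A j)
  /-- each factor has positive volume -/
  pos : ∀ j, 0 < (Λ j).haar (A j)

/-- A **direct product pre-region**: "a region that arises as a direct product of relatively compact
subsets in each of the direct summands". [cite: Mochizuki2012, IUTchIII Rmk. 3.1.1 (iii) p. 95] -/
@[mk_iff]
structure IsDirectProductPreRegion (A : ∀ j, Set (V j)) : Prop where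
  /-- each factor is relatively compact -/
  isCompact_closure : ∀ j, IsCompact (closure (A j))

omit [Fintype J] [∀ j, SecondCountableTopology (V j)] [∀ j, LocallyCompactSpace (V j)] in
/-- The factors of a direct product region have finite volume.
[cite: Mochizuki2012, IUTchIII Rmk. 3.1.1 (iii) p. 95] -/
theorem IsDirectProductRegion.lt_top {A : ∀ j, Set (V j)} (h : IsDirectProductRegion Λ A) (j : J) :
    (Λ j).haar (A j) < ∞ :=
  (Λ j).haar_lt_top_of_isCompact (h.isCompact j)

omit [Fintype J] [∀ j, SecondCountableTopology (V j)] [∀ j, LocallyCompactSpace (V j)] in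
/-- The integral structure `(Λ_j)_j` itself is a direct product region.
[cite: Mochizuki2012, IUTchIII Rmk. 3.1.1 (iii) p. 95] -/
theorem isDirectProductRegion_self : IsDirectProductRegion Λ (fun j => (Λ j : Set (V j))) :=
  ⟨fun j => (Λ j).isCompact, fun j => by rw [haar_self]; exact one_pos⟩

/-- The box of a direct product region has positive volume in the direct sum.
[cite: Mochizuki2012, IUTchIII Rmk. 3.1.1 (iii) p. 95] -/
theorem IsDirectProductRegion.haar_pi_pos {A : ∀ j, Set (V j)} (h : IsDirectProductRegion Λ A) :
    0 < (pi Λ).haar (Set.pi univ A) := by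
  rw [pi_haar_pi]
  exact pos_iff_ne_zero.mpr (Finset.prod_ne_zero_iff.mpr fun j _ => (h.pos j).ne')

/-- … and finite volume. [cite: Mochizuki2012, IUTchIII Rmk. 3.1.1 (iii) p. 95] -/
theorem IsDirectProductRegion.haar_pi_lt_top {A : ∀ j, Set (V j)} (h : IsDirectProductRegion Λ A) :
    (pi Λ).haar (Set.pi univ A) < ∞ := by
  rw [pi_haar_pi]
  exact ENNReal.prod_lt_top (fun j _ => h.lt_top Λ j)

/-- **The weighted log-volume** of a direct product region `S = ∏_j S_j` with weights `w = (w_j)`: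
`Σ_j w_j · μ^log_{Λ_j}(S_j)` — the "weighted sums of log-volumes" of [IUTchIII] Rmk. 3.1.1 (ii), in
the shape of the final display of Rmk. 3.1.1 (iv) "`(1/N_E)·μ^log_E(S) = Σ_v (1/N_v)·μ^log_v(S_v)`".
[cite: Mochizuki2012, IUTchIII Rmk. 3.1.1 (ii) p. 94, (iv) p. 97] -/
def weightedLogVolume (w : J → ℝ) (A : ∀ j, Set (V j)) : ℝ := ∑ j, w j * (Λ j).logVolume (A j)

omit [∀ j, SecondCountableTopology (V j)] [∀ j, LocallyCompactSpace (V j)] in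
/-- Unfolding the weighted log-volume. [cite: Mochizuki2012, IUTchIII Rmk. 3.1.1 (ii) p. 94] -/
theorem weightedLogVolume_eq_sum (w : J → ℝ) (A : ∀ j, Set (V j)) :
    weightedLogVolume Λ w A = ∑ j, w j * (Λ j).logVolume (A j) := rfl

omit [∀ j, SecondCountableTopology (V j)] [∀ j, LocallyCompactSpace (V j)] in
/-- The weighted log-volume of the integral structure `∏ Λ_j` is `0` for all weights ("the log-volume
of each of the "local holomorphic" integral structures … is equal to zero", [IUTchIII] Prop. 3.9 (i)).
[cite: Mochizuki2012, IUTchIII Prop. 3.9 (i) p. 115] -/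
@[simp] theorem weightedLogVolume_self (w : J → ℝ) :
    weightedLogVolume Λ w (fun j => (Λ j : Set (V j))) = 0 := by
  simp [weightedLogVolume]

omit [∀ j, SecondCountableTopology (V j)] [∀ j, LocallyCompactSpace (V j)] in
/-- Translation invariance of the weighted log-volume, factor by factor.
[cite: Mochizuki2012, IUTchIII Rmk. 3.1.1 (ii) p. 94] -/
@[simp] theorem weightedLogVolume_vadd (w : J → ℝ) (x : ∀ j, V j) (A : ∀ j, Set (V j)) :
    weightedLogVolume Λ w (fun j => x j +ᵥ A j) = weightedLogVolume Λ w A := by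
  simp [weightedLogVolume]

omit [∀ j, SecondCountableTopology (V j)] [∀ j, LocallyCompactSpace (V j)] in
/-- Monotonicity for nonnegative weights: `S_j ⊆ T_j` for all `j` (direct product regions) ⟹ weighted
log-volume of `S` ≤ that of `T`. [cite: Mochizuki2012, IUTchIII Rmk. 3.1.1 (ii) p. 94] -/
theorem weightedLogVolume_mono {w : J → ℝ} (hw : ∀ j, 0 ≤ w j) {A B : ∀ j, Set (V j)}
    (hA : IsDirectProductRegion Λ A) (hB : IsDirectProductRegion Λ B) (h : ∀ j, A j ⊆ B j) :
    weightedLogVolume Λ w A ≤ weightedLogVolume Λ w B := by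
  unfold weightedLogVolume
  exact Finset.sum_le_sum fun j _ =>
    mul_le_mul_of_nonneg_left ((Λ j).logVolume_mono (hA.pos j) (hB.lt_top Λ j) (h j)) (hw j)

/-- **Uniform weights recover the product log-volume**: with `w_j = 1/D` for all `j`, the weighted
log-volume of a direct product region is the weight-`D` normalised log-volume of its box in `⊕ V_j`
([IUTchIV] Prop. 1.4 (i): one tensor packet, "dividing by the degree").
[cite: Mochizuki2012, IUTchIV Prop. 1.4 (i) p. 13] -/
theorem weightedLogVolume_const_eq_normalizedLogVolume (D : ℕ) {A : ∀ j, Set (V j)}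
    (hA : IsDirectProductRegion Λ A) :
    weightedLogVolume Λ (fun _ => (D : ℝ)⁻¹) A = (pi Λ).normalizedLogVolume D (Set.pi univ A) := by
  rw [weightedLogVolume, normalizedLogVolume, pi_logVolume_pi Λ A hA.pos (hA.lt_top Λ),
    ← Finset.mul_sum, div_eq_inv_mul]

omit [∀ j, SecondCountableTopology (V j)] [∀ j, LocallyCompactSpace (V j)] in
/-- **Scaling, factor by factor**: for continuous additive automorphisms `φ_j` with `φ_j(Λ_j) ⊆ Λ_j`,
the weighted log-volume of `(φ_j(S_j))_j` is that of `S` minus `Σ_j w_j · log [Λ_j : φ_j(Λ_j)]`.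
[cite: Mochizuki2012, IUTchIII Rmk. 3.1.1 (ii) p. 94] -/
theorem weightedLogVolume_image (w : J → ℝ) (φ : ∀ j, V j ≃ₜ+ V j)
    (hφ : ∀ j, MapsTo (φ j) (Λ j : Set (V j)) (Λ j : Set (V j))) {A : ∀ j, Set (V j)}
    (hA : IsDirectProductRegion Λ A) :
    weightedLogVolume Λ w (fun j => φ j '' A j) = weightedLogVolume Λ w A -
      ∑ j, w j * Real.log (((Λ j).imageOpenAddSubgroup (φ j) : AddSubgroup (V j)).relIndex
        ((Λ j).toOpenAddSubgroup : AddSubgroup (V j))) := by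
  unfold weightedLogVolume
  rw [← Finset.sum_sub_distrib]
  refine Finset.sum_congr rfl fun j _ => ?_
  rw [(Λ j).logVolume_image_of_mapsTo (φ j) (hφ j) (hA.pos j) (hA.lt_top Λ j)]
  ring

omit [∀ j, SecondCountableTopology (V j)] [∀ j, LocallyCompactSpace (V j)] in
/-- **The normalisation theorem** ("normalized so that multiplication by `p_{v_ℚ}` affects log-volumes
by … subtraction of the quantity `log(p_{v_ℚ})`"): if `[Λ_j : φ_j(Λ_j)] = b^{D_j}` for every `j` and
the weights satisfy `Σ_j w_j · D_j = 1`, then applying `(φ_j)_j` lowers the weighted log-volume of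
every direct product region by exactly `log b`. [cite: Mochizuki2012, IUTchIII Rmk. 3.1.1 (ii) p. 94] -/
theorem weightedLogVolume_image_of_relIndex_eq_pow (w : J → ℝ) (φ : ∀ j, V j ≃ₜ+ V j)
    (hφ : ∀ j, MapsTo (φ j) (Λ j : Set (V j)) (Λ j : Set (V j))) {b : ℕ} {D : J → ℕ}
    (hidx : ∀ j, ((Λ j).imageOpenAddSubgroup (φ j) : AddSubgroup (V j)).relIndex
        ((Λ j).toOpenAddSubgroup : AddSubgroup (V j)) = b ^ (D j))
    (hw : ∑ j, w j * D j = 1) {A : ∀ j, Set (V j)} (hA : IsDirectProductRegion Λ A) :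
    weightedLogVolume Λ w (fun j => φ j '' A j) = weightedLogVolume Λ w A - Real.log b := by
  rw [weightedLogVolume_image Λ w φ hφ hA]
  congr 1
  simp_rw [hidx, Nat.cast_pow, Real.log_pow, ← mul_assoc, ← Finset.sum_mul, hw, one_mul]

omit [∀ j, SecondCountableTopology (V j)] [∀ j, LocallyCompactSpace (V j)] in
/-- In particular the image `(φ_j(Λ_j))_j` of the integral structure has weighted log-volume `−log b`
("`μ^log(p·(R_E)^∼) = −log(p)`"). [cite: Mochizuki2012, IUTchIV Prop. 1.4 (i) p. 13] -/
theorem weightedLogVolume_image_self_of_relIndex_eq_pow (w : J → ℝ) (φ : ∀ j, V j ≃ₜ+ V j)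
    (hφ : ∀ j, MapsTo (φ j) (Λ j : Set (V j)) (Λ j : Set (V j))) {b : ℕ} {D : J → ℕ}
    (hidx : ∀ j, ((Λ j).imageOpenAddSubgroup (φ j) : AddSubgroup (V j)).relIndex
        ((Λ j).toOpenAddSubgroup : AddSubgroup (V j)) = b ^ (D j))
    (hw : ∑ j, w j * D j = 1) :
    weightedLogVolume Λ w (fun j => φ j '' (Λ j : Set (V j))) = -Real.log b := by
  rw [weightedLogVolume_image_of_relIndex_eq_pow Λ w φ hφ hidx hw (isDirectProductRegion_self Λ),
    weightedLogVolume_self, zero_sub]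

/-! ### (3) Mochizuki's normalized weights -/

/-- **The normalized weight** of [IUTchIII] Rmk. 3.1.1 (ii): for the summand `j` (a valuation `v | v_ℚ`
of `K`, in bijection with `w ∈ V_mod`), with `N_j = [K_v : (F_mod)_v]` and `D_j = [(F_mod)_w : ℚ_{v_ℚ}]`,
the weight `1 / (N_j · Σ_i D_i)` ("the normalized weight `1/([K_v : (F_mod)_v]·(Σ_{V_mod∋w|v_ℚ}
[(F_mod)_w : ℚ_{v_ℚ}]))`"). [cite: Mochizuki2012, IUTchIII Rmk. 3.1.1 (ii) p. 94] -/
def normalizedWeight (N D : J → ℕ) (j : J) : ℝ := 1 / ((N j : ℝ) * ∑ i, (D i : ℝ))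

/-- The normalized weights are nonnegative. [cite: Mochizuki2012, IUTchIII Rmk. 3.1.1 (ii) p. 94] -/
theorem normalizedWeight_nonneg (N D : J → ℕ) (j : J) : 0 ≤ normalizedWeight N D j :=
  div_nonneg zero_le_one
    (mul_nonneg (Nat.cast_nonneg _) (Finset.sum_nonneg fun i _ => Nat.cast_nonneg (D i)))

/-- **The normalized weights are normalized**: with degrees `d_j = N_j · D_j` (= `[K_v : ℚ_{v_ℚ}]`),
`Σ_j w_j · d_j = 1` (provided all `N_j ≥ 1` and some `D_j ≥ 1`) — the hypothesis `hw` of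
`weightedLogVolume_image_of_relIndex_eq_pow`, i.e. "normalized so that multiplication by `p_{v_ℚ}`
affects log-volumes by … subtraction of … `log(p_{v_ℚ})`".
[cite: Mochizuki2012, IUTchIII Rmk. 3.1.1 (ii) p. 94] -/
theorem sum_normalizedWeight_mul_degree (N D : J → ℕ) (hN : ∀ j, N j ≠ 0)
    (hD : ∑ i, (D i : ℝ) ≠ 0) :
    ∑ j, normalizedWeight N D j * ((N j * D j : ℕ) : ℝ) = 1 := by
  unfold normalizedWeight
  have h : ∀ j, 1 / ((N j : ℝ) * ∑ i, (D i : ℝ)) * ((N j * D j : ℕ) : ℝ) =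
      (D j : ℝ) / ∑ i, (D i : ℝ) := fun j => by
    have hNj : (N j : ℝ) ≠ 0 := by exact_mod_cast hN j
    push_cast
    field_simp
  simp_rw [h, ← Finset.sum_div]
  exact div_self hD

omit [∀ j, SecondCountableTopology (V j)] [∀ j, LocallyCompactSpace (V j)] in
/-- Consequently, with Mochizuki's normalized weights and `[Λ_j : φ_j(Λ_j)] = b^{N_j D_j}`
(e.g. `b = p_{v_ℚ}`, `φ_j = p_{v_ℚ}·(−)`, `N_j D_j = [K_{v_j} : ℚ_{p}]`), applying `(φ_j)` subtracts
exactly `log b` from the weighted log-volume of any direct product region.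
[cite: Mochizuki2012, IUTchIII Rmk. 3.1.1 (ii) p. 94] -/
theorem weightedLogVolume_normalizedWeight_image (N D : J → ℕ) (hN : ∀ j, N j ≠ 0)
    (hD : ∑ i, (D i : ℝ) ≠ 0) (φ : ∀ j, V j ≃ₜ+ V j)
    (hφ : ∀ j, MapsTo (φ j) (Λ j : Set (V j)) (Λ j : Set (V j))) {b : ℕ}
    (hidx : ∀ j, ((Λ j).imageOpenAddSubgroup (φ j) : AddSubgroup (V j)).relIndex
        ((Λ j).toOpenAddSubgroup : AddSubgroup (V j)) = b ^ (N j * D j))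
    {A : ∀ j, Set (V j)} (hA : IsDirectProductRegion Λ A) :
    weightedLogVolume Λ (normalizedWeight N D) (fun j => φ j '' A j) =
      weightedLogVolume Λ (normalizedWeight N D) A - Real.log b :=
  weightedLogVolume_image_of_relIndex_eq_pow Λ (normalizedWeight N D) φ hφ hidx
    (sum_normalizedWeight_mul_degree N D hN hD) hA

end IntegralStructure

end Literature.IUT.LogVolume
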